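import Summits.QuantumFields.BalabanUV.Beta.GAN24.CapacitanceRateScaled
import Summits.QuantumFields.BalabanUV.Beta.GAN24.ClosedFormRateOfParts
import Summits.QuantumFields.BalabanUV.Beta.GAN24.CombesThomas

/-!
# `BalabanUV.Beta.GAN24.FibreRateMF` — binder row G-an2-4 / (CONV-C), road P1-fibre, leaf **P1-L11** `FibreRate` (Part B), PART F-mf: the MULTIPLIER RESPONSE
# `phiSol` as «unit-normalised Cap⁻¹ blocks × unit-normalised source-side sums», and the multiplier–field leg rate `θ^j` AS A FUNCTION of the source-side data

NOT IN PRINT; OUR PROOF ATTEMPT.  HONEST FRAMING (cell contract, verbatim): «discharging `BetaPertH` makes Bałaban's UV stability UNCONDITIONAL — a real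
constructive-QFT result; it is NOT the continuum limit and NOT the Clay problem.»  HONEST DEPENDENCY (verbatim): «continuum YM on T⁴ ⇐ BetaPertH ∧ nine spine
estimates (0/9 proved); BetaPertH ⇐ (D1) ∧ (D4) ∧ CAP+tail; G-an2-4 gates asym, D1 and NE2/3/4.»  [folklore] finite-sum algebra over T00's definitions
(`AliasObjects.capSol/phiSol/srcPhi/srcC`) + the products of this seat's capacitance half (`CapacitanceRate{,Dictionary,Scaled}`, `CapacitanceEndpoint(Blocks)`)
with leaf-11's two-factor telescoping (`ClosedFormRateOfParts.norm_mul_sub_mul_le_of_bounds`) BY NAME; units `CombesThomas.sfStep/smStep` BY NAME (TRIGGER-P1 c2);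
no cited fact, no wall binder, no `def`, no `def … : Prop` hypothesis — the source-side bounds/rates are ORDINARY HYPOTHESES (PART S, leaf-07-g6, supplies them).
NOT summit progress: one leg of shape (I2′); nothing of (CONV-C)'s K-slot is discharged; 0 wall binders instantiated; NOT `BetaPertH`, NOT continuum, NOT Clay.

## What is proved
* `phiSol_eq_sum` (every `D`, `N`, complex `p`): `phiSol N p f̂ ĉ κ = Σ_{l′} (cap N p)⁻¹_{κl′}·srcPhi … l′ + (cap N p)⁻¹_{κc}·srcC …`;
  `scaled_phiSol_eq`: `N^{D+1}·phiSol = Σ_{l′} (N^{D+4}·cap⁻¹_{κl′})·(N⁻³·srcPhi l′) + (N^{D+4}·cap⁻¹_{κc})·(N⁻³·srcC)`;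
* **`norm_scaled_phiSol_sub_le`** (every `D`, `1 ≤ N ≤ N′`, `q ∈ [−π, π]^D ∖ {0}`, zero constraint source, any forces `f̂`, `f̂′`): from
  `‖N′⁻³·srcPhi′ l′‖ ≤ B_φ`, `‖N′⁻³·srcC′‖ ≤ B_c`, `‖N′⁻³srcPhi′ l′ − N⁻³srcPhi l′‖ ≤ R_φ/N²`, `‖N′⁻³srcC′ − N⁻³srcC‖ ≤ R_c/N²` conclude
  `‖N′^{D+1}φ′_κ − N^{D+1}φ_κ‖ ≤ (D(crPP·|q|⁴·B_φ + cPP·|q|²·R_φ) + crPc·|q|⁴√|q|²·B_c + cPc·|q|²√|q|²·R_c)/N²`;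
* `d = 3`: `smStep_mul_sfStep_three` (`sm_j·sf_j = (Lc^{j+1})^5/Lc^5`), `smsf_mul_phiSol_eq`, and **`mf_rate_of_source_data`**: the hypothesis `hmf` of
  `ClosedFormRateOfParts.norm_kFibClosed_succ_sub_le_of_parts` / `FibreRateOfLegs.realRateK_of_leg_rates` follows with
  `c_mf(q) = (4(crPP·|q|⁴B_φ + cPP·|q|²R_φ) + crPc·|q|⁴√|q|²B_c + cPc·|q|²√|q|²R_c)/Lc^7` times `(Lc⁻²)^j`.

Unit `b2b-balaban-gan24-formalise-leaf-20` (G-an2-4 formalisation swarm, leaf prover 20), 2026-08-20.  Value = kernel assembly leaf toward the K-slot route P1,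
NOT summit progress.
-/

noncomputable section

open Complex Finset
open scoped BigOperators Real

namespace Summit.QuantumFields.BalabanUV.Beta.GAN24.FibreRateMF

open Literature.MathematicalPhysics.QuantumFieldTheory.Balaban1983to89.B4Strip (ofRealVec)
open Literature.MathematicalPhysics.QuantumFieldTheory.King1986 (momSq momSq_nonneg)
open CapacitanceScalarBounds (momSq_pos)
open CapacitanceRateDictionary (scaled_cap_inv_inl_inl scaled_cap_inv_inl_inr norm_invPP_aT_le norm_invPc_aT_le)
open CapacitanceRateScaled (crPP crPc scaled_cap_inv_inl_inl_rate scaled_cap_inv_inl_inr_rate)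

/-! ## The multiplier response `phiSol` as «Cap⁻¹ blocks × source-side sums», scaled; its two-level rate as a function of the source-side data -/

section MF
open Literature.Probability.LatticeModels (TorusSite)
open AliasObjects (cap capSol phiSol srcPhi srcC)
open CapacitanceEndpointBlocks (cPP cPc cPP_pos cPc_pos)

variable {D : ℕ}

/-- [folklore] **`phiSol` IS A ROW OF `(cap N p)⁻¹` AGAINST THE SOURCES**: `phiSol N p f̂ ĉ κ = Σ_{l′} (cap⁻¹)_{κl′}·r_φ(l′) + (cap⁻¹)_{κc}·r_c`
(T00's `capSol = (cap N p)⁻¹ *ᵥ (r_φ; r_c)` written out; every complex `p`). -/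
theorem phiSol_eq_sum (N : ℕ) [NeZero N] (p : Fin D → ℂ) (fhat : TorusSite D N → Fin D → ℂ) (chat : Fin D → ℂ) (κ : Fin D) :
    phiSol N p fhat chat κ = ∑ l', (cap N p)⁻¹ (Sum.inl κ) (Sum.inl l') * srcPhi N p fhat chat l'
      + (cap N p)⁻¹ (Sum.inl κ) (Sum.inr ()) * srcC N p fhat := by
  unfold AliasObjects.phiSol AliasObjects.capSol
  simp [Matrix.mulVec, dotProduct, Fintype.sum_sum_type]

/-- [folklore] **SCALED FORM**: `N^{D+1}·phiSol = Σ_{l′} (N^{D+4}(cap⁻¹)_{κl′})·(N⁻³ r_φ(l′)) + (N^{D+4}(cap⁻¹)_{κc})·(N⁻³ r_c)` — unit-normalised blocks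
(L08/PART C) times unit-normalised source-side sums (PART S's unit `N⁻³`). -/
theorem scaled_phiSol_eq {N : ℕ} [NeZero N] (hN : 1 ≤ N) (p : Fin D → ℂ) (fhat : TorusSite D N → Fin D → ℂ) (chat : Fin D → ℂ) (κ : Fin D) :
    (N : ℂ) ^ (D + 1) * phiSol N p fhat chat κ
      = ∑ l', ((N : ℂ) ^ (D + 4) * (cap N p)⁻¹ (Sum.inl κ) (Sum.inl l')) * ((((N : ℂ) ^ 3)⁻¹) * srcPhi N p fhat chat l')
        + ((N : ℂ) ^ (D + 4) * (cap N p)⁻¹ (Sum.inl κ) (Sum.inr ())) * ((((N : ℂ) ^ 3)⁻¹) * srcC N p fhat) := by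
  have hN0 : (N : ℂ) ≠ 0 := by exact_mod_cast (by omega : N ≠ 0)
  have e : ∀ X S : ℂ, (N : ℂ) ^ (D + 1) * (X * S) = ((N : ℂ) ^ (D + 4) * X) * ((((N : ℂ) ^ 3)⁻¹) * S) := by
    intro X S; field_simp; ring
  rw [phiSol_eq_sum, mul_add, Finset.mul_sum]
  simp only [e]

variable {N N' : ℕ} [NeZero N] [NeZero N'] {q : Fin D → ℝ}

/-- **TWO-LEVEL RATE OF THE SCALED MULTIPLIER RESPONSE, AS A FUNCTION OF THE SOURCE-SIDE DATA** [folklore]: for `1 ≤ N ≤ N′`,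
`q ∈ [−π, π]^D ∖ {0}`, zero constraint source, arbitrary force families `f̂` (level `N`) and `f̂′` (level `N′`): if the unit-normalised source-side sums
obey `‖N′⁻³ r_φ′(l′)‖ ≤ B_φ`, `‖N′⁻³ r_c′‖ ≤ B_c` and the two-level rates `‖N′⁻³ r_φ′(l′) − N⁻³ r_φ(l′)‖ ≤ R_φ/N²`, `‖N′⁻³ r_c′ − N⁻³ r_c‖ ≤ R_c/N²`
(PART S, leaf-07), then with the block bounds of L08 and the block rates of PART C
`‖N′^{D+1} φ′_κ − N^{D+1} φ_κ‖ ≤ (D·(crPP·|q|⁴·B_φ + cPP·|q|²·R_φ) + crPc·|q|⁴√|q|²·B_c + cPc·|q|²√|q|²·R_c)/N²`. -/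
theorem norm_scaled_phiSol_sub_le (hN : 1 ≤ N) (hNN' : N ≤ N') (hq : ∀ i, |q i| ≤ π) (hq0 : q ≠ 0)
    {fhat : TorusSite D N → Fin D → ℂ} {fhat' : TorusSite D N' → Fin D → ℂ} {Bφ Bc Rφ Rc : ℝ}
    (hBφ : ∀ l', ‖(((N' : ℂ) ^ 3)⁻¹) * srcPhi N' (ofRealVec q) fhat' 0 l'‖ ≤ Bφ)
    (hBc : ‖(((N' : ℂ) ^ 3)⁻¹) * srcC N' (ofRealVec q) fhat'‖ ≤ Bc)
    (hRφ : ∀ l', ‖(((N' : ℂ) ^ 3)⁻¹) * srcPhi N' (ofRealVec q) fhat' 0 l' - (((N : ℂ) ^ 3)⁻¹) * srcPhi N (ofRealVec q) fhat 0 l'‖ ≤ Rφ / (N : ℝ) ^ 2)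
    (hRc : ‖(((N' : ℂ) ^ 3)⁻¹) * srcC N' (ofRealVec q) fhat' - (((N : ℂ) ^ 3)⁻¹) * srcC N (ofRealVec q) fhat‖ ≤ Rc / (N : ℝ) ^ 2) (κ : Fin D) :
    ‖(N' : ℂ) ^ (D + 1) * phiSol N' (ofRealVec q) fhat' 0 κ - (N : ℂ) ^ (D + 1) * phiSol N (ofRealVec q) fhat 0 κ‖
      ≤ (D * (crPP D * momSq q ^ 2 * Bφ + cPP D * momSq q * Rφ)
          + crPc D * (momSq q ^ 2 * Real.sqrt (momSq q)) * Bc + cPc D * (momSq q * Real.sqrt (momSq q)) * Rc) / (N : ℝ) ^ 2 := by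
  have hN' : 1 ≤ N' := hN.trans hNN'
  have hN0 : (0 : ℝ) < N := by exact_mod_cast hN
  have hP := momSq_pos hq0
  rw [scaled_phiSol_eq hN', scaled_phiSol_eq hN, show ∀ (a b c e : ℂ), (a + b) - (c + e) = (a - c) + (b - e) from fun _ _ _ _ => by ring,
    ← Finset.sum_sub_distrib]
  -- block data
  have hX : ∀ l', ‖(N : ℂ) ^ (D + 4) * (cap N (ofRealVec q))⁻¹ (Sum.inl κ) (Sum.inl l')‖ ≤ cPP D * momSq q := fun l' => by
    rw [scaled_cap_inv_inl_inl hN hq hq0]; exact norm_invPP_aT_le hN hq hq0 κ l'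
  have hΔX : ∀ l', ‖(N' : ℂ) ^ (D + 4) * (cap N' (ofRealVec q))⁻¹ (Sum.inl κ) (Sum.inl l')
      - (N : ℂ) ^ (D + 4) * (cap N (ofRealVec q))⁻¹ (Sum.inl κ) (Sum.inl l')‖ ≤ crPP D * momSq q ^ 2 / (N : ℝ) ^ 2 :=
    fun l' => scaled_cap_inv_inl_inl_rate hN hNN' hq hq0 κ l'
  have hXc : ‖(N : ℂ) ^ (D + 4) * (cap N (ofRealVec q))⁻¹ (Sum.inl κ) (Sum.inr ())‖ ≤ cPc D * (momSq q * Real.sqrt (momSq q)) := by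
    rw [scaled_cap_inv_inl_inr hN hq hq0]; exact norm_invPc_aT_le hN hq hq0 κ
  have hΔXc : ‖(N' : ℂ) ^ (D + 4) * (cap N' (ofRealVec q))⁻¹ (Sum.inl κ) (Sum.inr ())
      - (N : ℂ) ^ (D + 4) * (cap N (ofRealVec q))⁻¹ (Sum.inl κ) (Sum.inr ())‖ ≤ crPc D * (momSq q ^ 2 * Real.sqrt (momSq q)) / (N : ℝ) ^ 2 :=
    scaled_cap_inv_inl_inr_rate hN hNN' hq hq0 κ ()
  refine (norm_add_le _ _).trans ?_
  have hsum : ‖∑ l', ((N' : ℂ) ^ (D + 4) * (cap N' (ofRealVec q))⁻¹ (Sum.inl κ) (Sum.inl l') * ((((N' : ℂ) ^ 3)⁻¹) * srcPhi N' (ofRealVec q) fhat' 0 l')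
        - (N : ℂ) ^ (D + 4) * (cap N (ofRealVec q))⁻¹ (Sum.inl κ) (Sum.inl l') * ((((N : ℂ) ^ 3)⁻¹) * srcPhi N (ofRealVec q) fhat 0 l'))‖
      ≤ D * (crPP D * momSq q ^ 2 * Bφ + cPP D * momSq q * Rφ) / (N : ℝ) ^ 2 := by
    refine (norm_sum_le _ _).trans ?_
    calc ∑ l', ‖(N' : ℂ) ^ (D + 4) * (cap N' (ofRealVec q))⁻¹ (Sum.inl κ) (Sum.inl l') * ((((N' : ℂ) ^ 3)⁻¹) * srcPhi N' (ofRealVec q) fhat' 0 l')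
          - (N : ℂ) ^ (D + 4) * (cap N (ofRealVec q))⁻¹ (Sum.inl κ) (Sum.inl l') * ((((N : ℂ) ^ 3)⁻¹) * srcPhi N (ofRealVec q) fhat 0 l')‖
        ≤ ∑ _l' : Fin D, (crPP D * momSq q ^ 2 / (N : ℝ) ^ 2 * Bφ + cPP D * momSq q * (Rφ / (N : ℝ) ^ 2)) :=
          Finset.sum_le_sum fun l' _ =>
            ClosedFormRateOfParts.norm_mul_sub_mul_le_of_bounds (hX l') (hBφ l') (hΔX l') (hRφ l')
      _ = D * (crPP D * momSq q ^ 2 * Bφ + cPP D * momSq q * Rφ) / (N : ℝ) ^ 2 := by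
          rw [Finset.sum_const, Finset.card_univ, Fintype.card_fin, nsmul_eq_mul]
          field_simp
  have hc : ‖(N' : ℂ) ^ (D + 4) * (cap N' (ofRealVec q))⁻¹ (Sum.inl κ) (Sum.inr ()) * ((((N' : ℂ) ^ 3)⁻¹) * srcC N' (ofRealVec q) fhat')
        - (N : ℂ) ^ (D + 4) * (cap N (ofRealVec q))⁻¹ (Sum.inl κ) (Sum.inr ()) * ((((N : ℂ) ^ 3)⁻¹) * srcC N (ofRealVec q) fhat)‖
      ≤ (crPc D * (momSq q ^ 2 * Real.sqrt (momSq q)) * Bc + cPc D * (momSq q * Real.sqrt (momSq q)) * Rc) / (N : ℝ) ^ 2 := by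
    refine (ClosedFormRateOfParts.norm_mul_sub_mul_le_of_bounds hXc hBc hΔXc hRc).trans (le_of_eq ?_)
    field_simp
  refine (add_le_add hsum hc).trans (le_of_eq ?_)
  field_simp
  ring

end MF

/-! ## The multiplier–field leg at `d = 3`: units `smStep 3 Lc j · sfStep Lc j = N⁵/Lc⁵` and the rate `θ^j` as a function of the source-side data -/

section MF3
open Literature.Probability.LatticeModels (TorusSite)
open AliasObjects (phiSol srcPhi srcC)
open CombesThomas (sfStep smStep)
open CapacitanceEndpointBlocks (cPP cPc)

variable {Lc : ℕ} [NeZero Lc]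

omit [NeZero Lc] in
/-- [folklore] **THE UNITS MATCH AT `d = 3`**: `smStep 3 Lc j · sfStep Lc j = (Lc^{j+1})^5 / Lc^5` (`Lc^{4j}·Lc^j = N^{D+1}/Lc^{D+1}`, `N = Lc^{j+1}`, `D = 4`;
`CombesThomas.sfStep/smStep` BY NAME — TRIGGER-P1 c2). -/
theorem smStep_mul_sfStep_three (hLc : (Lc : ℝ) ≠ 0) (j : ℕ) :
    smStep 3 Lc j * sfStep Lc j = ((Lc : ℝ) ^ (j + 1)) ^ (3 + 1 + 1) / (Lc : ℝ) ^ 5 := by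
  unfold CombesThomas.smStep CombesThomas.sfStep
  rw [eq_div_iff (pow_ne_zero _ hLc), ← pow_add, ← pow_mul, ← pow_add]
  congr 1
  ring

/-- [folklore] The scaled mf response: `sm_j·sf_j·φ = Lc^{−5}·(N^{D+1}·φ)`, `N = Lc^{j+1}`. -/
theorem smsf_mul_phiSol_eq (j : ℕ) (p : Fin (3 + 1) → ℂ) (fhat : TorusSite (3 + 1) (Lc ^ (j + 1)) → Fin (3 + 1) → ℂ) (κ : Fin (3 + 1)) :
    ((smStep 3 Lc j * sfStep Lc j : ℝ) : ℂ) * phiSol (Lc ^ (j + 1)) p fhat 0 κ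
      = ((Lc : ℂ) ^ 5)⁻¹ * ((((Lc ^ (j + 1) : ℕ) : ℂ) ^ (3 + 1 + 1)) * phiSol (Lc ^ (j + 1)) p fhat 0 κ) := by
  have hLc : (Lc : ℝ) ≠ 0 := Nat.cast_ne_zero.2 (NeZero.ne Lc)
  have hLcC : (Lc : ℂ) ^ 5 ≠ 0 := pow_ne_zero _ (Nat.cast_ne_zero.2 (NeZero.ne Lc))
  rw [smStep_mul_sfStep_three hLc]
  push_cast
  field_simp

/-- **ROW L11, mf LEG AS A FUNCTION OF THE SOURCE-SIDE DATA** [folklore] (`d = 3`, literal units): for every `j`, `q ∈ [−π, π]^4 ∖ {0}`, force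
families `f̂` at level `N = Lc^{j+1}` and `f̂′` at `N′ = Lc^{j+2}` (the assembly takes `f̂ = fhatF N (Lc^j) p l y′`, `f̂′ = fhatF N′ N p l y′`) whose
source-side sums obey PART S's bound/rate shapes at unit `N⁻³`, the unit-scaled multiplier response has the ONE-STEP RATE
`‖sm_{j+1}sf_{j+1}·φ′_κ − sm_j sf_j·φ_κ‖ ≤ (4(crPP·|q|⁴·B_φ + cPP·|q|²·R_φ) + crPc·|q|⁴√|q|²·B_c + cPc·|q|²√|q|²·R_c)/Lc^7 · (Lc⁻²)^j`. -/
theorem mf_rate_of_source_data (j : ℕ) {q : Fin (3 + 1) → ℝ} (hq : ∀ i, |q i| ≤ π) (hq0 : q ≠ 0)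
    {fhat : TorusSite (3 + 1) (Lc ^ (j + 1)) → Fin (3 + 1) → ℂ} {fhat' : TorusSite (3 + 1) (Lc ^ (j + 2)) → Fin (3 + 1) → ℂ} {Bφ Bc Rφ Rc : ℝ}
    (hBφ : ∀ l', ‖((((Lc ^ (j + 2) : ℕ) : ℂ) ^ 3)⁻¹) * srcPhi (Lc ^ (j + 2)) (ofRealVec q) fhat' 0 l'‖ ≤ Bφ)
    (hBc : ‖((((Lc ^ (j + 2) : ℕ) : ℂ) ^ 3)⁻¹) * srcC (Lc ^ (j + 2)) (ofRealVec q) fhat'‖ ≤ Bc)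
    (hRφ : ∀ l', ‖((((Lc ^ (j + 2) : ℕ) : ℂ) ^ 3)⁻¹) * srcPhi (Lc ^ (j + 2)) (ofRealVec q) fhat' 0 l'
        - ((((Lc ^ (j + 1) : ℕ) : ℂ) ^ 3)⁻¹) * srcPhi (Lc ^ (j + 1)) (ofRealVec q) fhat 0 l'‖ ≤ Rφ / (((Lc ^ (j + 1) : ℕ) : ℝ)) ^ 2)
    (hRc : ‖((((Lc ^ (j + 2) : ℕ) : ℂ) ^ 3)⁻¹) * srcC (Lc ^ (j + 2)) (ofRealVec q) fhat'
        - ((((Lc ^ (j + 1) : ℕ) : ℂ) ^ 3)⁻¹) * srcC (Lc ^ (j + 1)) (ofRealVec q) fhat‖ ≤ Rc / (((Lc ^ (j + 1) : ℕ) : ℝ)) ^ 2) (κ : Fin (3 + 1)) :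
    ‖((smStep 3 Lc (j + 1) * sfStep Lc (j + 1) : ℝ) : ℂ) * phiSol (Lc ^ (j + 2)) (ofRealVec q) fhat' 0 κ
        - ((smStep 3 Lc j * sfStep Lc j : ℝ) : ℂ) * phiSol (Lc ^ (j + 1)) (ofRealVec q) fhat 0 κ‖
      ≤ ((3 + 1 : ℕ) * (crPP (3 + 1) * momSq q ^ 2 * Bφ + cPP (3 + 1) * momSq q * Rφ)
          + crPc (3 + 1) * (momSq q ^ 2 * Real.sqrt (momSq q)) * Bc + cPc (3 + 1) * (momSq q * Real.sqrt (momSq q)) * Rc) / (Lc : ℝ) ^ 7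
        * (((Lc : ℝ) ^ 2)⁻¹) ^ j := by
  have hLc1 : 1 ≤ Lc := Nat.one_le_iff_ne_zero.2 (NeZero.ne Lc)
  have hLc0 : (0 : ℝ) < Lc := by exact_mod_cast hLc1
  have hN : 1 ≤ Lc ^ (j + 1) := Nat.one_le_pow _ _ hLc1
  have hNN' : Lc ^ (j + 1) ≤ Lc ^ (j + 2) := Nat.pow_le_pow_right hLc1 (by omega)
  have h := norm_scaled_phiSol_sub_le (D := 3 + 1) hN hNN' hq hq0 hBφ hBc hRφ hRc κ
  rw [smsf_mul_phiSol_eq (j + 1) (ofRealVec q) fhat' κ, smsf_mul_phiSol_eq j (ofRealVec q) fhat κ, ← mul_sub, norm_mul, norm_inv, norm_pow,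
    Complex.norm_natCast]
  set K := (3 + 1 : ℕ) * (crPP (3 + 1) * momSq q ^ 2 * Bφ + cPP (3 + 1) * momSq q * Rφ)
          + crPc (3 + 1) * (momSq q ^ 2 * Real.sqrt (momSq q)) * Bc + cPc (3 + 1) * (momSq q * Real.sqrt (momSq q)) * Rc with hK
  have e : ((Lc : ℝ) ^ 5)⁻¹ * (K / (((Lc ^ (j + 1) : ℕ) : ℝ)) ^ 2) = K / (Lc : ℝ) ^ 7 * (((Lc : ℝ) ^ 2)⁻¹) ^ j := by
    have hL2 : (((Lc : ℝ) ^ 2)⁻¹) ^ j = ((Lc : ℝ) ^ (2 * j))⁻¹ := by rw [inv_pow, ← pow_mul]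
    push_cast
    rw [hL2]
    field_simp
    ring
  rw [← e]
  refine mul_le_mul_of_nonneg_left ?_ (inv_nonneg.2 (pow_nonneg hLc0.le 5))
  convert h using 2

end MF3

end Summit.QuantumFields.BalabanUV.Beta.GAN24.FibreRateMF

end
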